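import Mathlib
import HarnessLib
import Summits.NavierStokesRegularity.NavierStokesRegularity.Theorems.PoloidalWindowDoorLrcModEntireSonicWebsParallel

/-!
# Route `PoloidalWindowDoor`, item `LrcModEntire` (stmt-NavierStokesRegularity-20428), cell (Q4-sonic, straight, μ < 0) `stub_Q4sonicLineNeg`, case I —
# BRICK B-T ON THE FULL HEIGHT WINDOW (uniform in τ)

Cell ns-regularity-ideate, stub-worker seat ns-poloidal-K2-p2 g16 under the LEAD of item 20428 (ns-poloidal-K2-p3 g17);
`--supports stmt-NavierStokesRegularity-20428 --as helper`.  `…SonicWebsParallel.sonic_webs_parallel` (p739887) gives the parallel webs at a sonic time `τ` on SOME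
height window `δ′(τ) > 0`; since the web function is real-analytic (`…Q4LineWeb.contDiffAt_webFun`, C^ω implicit function theorem) the identity
«maximiser at `(τ,s,z)` = maximiser at `(τ,0,z)`» propagates in `z` to the FULL window `|z| < δ` (identity theorem on `(−δ, δ)`), uniformly in `τ` — the form
LEAD's A-I needs on a space–time box.

* ★ `sonic_webs_parallel_window` — hypotheses of `sonic_webs_parallel` ⊢ for all `s` and `|z| < δ`: two cross-section maximisers at `(τ,s,z)` and `(τ,0,z)` coincide.
* `sonic_webs_parallel_timeWeb_window` — in port-2's `time_web_package_line` currency: `n₀(τ,s,z) = n₀(τ,0,z)` for all `s` and `|z| < min δ δ₀`.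

WHAT THIS IS NOT: not a claim about Navier–Stokes regularity; no registered slot closes; items 20428 / 19708 / 27893 OPEN (bears_on LADDER-NS N0).
-/

noncomputable section

-- the summit and its single sub-problem share the name (CONVENTIONS §1), as in every Theorems file
set_option linter.dupNamespace false

namespace Summit.NavierStokesRegularity.NavierStokesRegularity.Theorems.PoloidalWindowDoorLrcModEntireSonicWebsParallelWindow

open Set Function Filter Topology Metric
open scoped RealInnerProductSpace InnerProductSpace Laplacian ContDiff
open Literature.Analysis Literature.Analysis.FluidPDE Literature.Analysis.UnboundedOperators
open Summit.NavierStokesRegularity.NavierStokesRegularity.Theorems.PoloidalWindowDoorLrcModEntireSheetFlattenTools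
open Summit.NavierStokesRegularity.NavierStokesRegularity.Theorems.PoloidalWindowDoorLrcModEntireQ4LineWeb
open Summit.NavierStokesRegularity.NavierStokesRegularity.Theorems.LocalSineTubeDoorProfileAlignedWindowRigidityAncient
open Summit.NavierStokesRegularity.NavierStokesRegularity.Theorems.PoloidalWindowDoorLrcModEntireSonicWebsParallel

/-- ★ **B-T ON THE FULL HEIGHT WINDOW.**  Under the hypotheses of `sonic_webs_parallel`, for every `s` and every `|z| < δ` the cross-section maximisers at `(τ, s, z)`
and at `(τ, 0, z)` coincide (the web function is real-analytic in `z`; identity theorem). -/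
theorem sonic_webs_parallel_window {C : ℝ} {U : ℝ → EuclideanSpace ℝ (Fin 3) → EuclideanSpace ℝ (Fin 3)} {Γ νΓ : ℝ → EuclideanSpace ℝ (Fin 3)}
    {R μ : ℝ → ℝ → ℝ} {σ r δ ρ τ : ℝ}
    (hUrate : HasTypeITimeDecay C U) (hUcont : ContinuousOn (uncurry U) (Iio (0 : ℝ) ×ˢ univ))
    (hUmild : ∀ s t : ℝ, s < t → t < 0 → ∀ x, U t x = heatExtension (U s) (t - s) x - oseenDuhamel 1 s U U t x)
    (hUdiv : ∀ t < 0, VectorCalculus.IsDivFree (U t))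
    (hUpol : ∀ s < 0, ∀ q, ⟪curl (U s) q, EuclideanSpace.single 2 1⟫_ℝ = 0)
    (hσ : σ = 1 ∨ σ = -1)
    (hΓ2 : ∀ s, Γ s 2 = 0) (hΓunit : ∀ s, ‖deriv Γ s‖ = 1)
    (hν : ∀ s, νΓ s = WithLp.toLp 2 ![-(deriv Γ s 1), deriv Γ s 0, 0])
    (hline : ∀ s : ℝ, Γ s = s • deriv Γ 0)
    (hδ : 0 < δ)
    (hconc : ∀ τ z : ℝ, |τ| < δ → |z| < δ → ∀ s : ℝ, ∀ n ∈ Ioo (-r) r,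
      fderiv ℝ (fderiv ℝ (fun y => σ * U (-1 + τ) y 2)) (Γ s + n • νΓ s + z • EuclideanSpace.single 2 (1 : ℝ)) (νΓ s) (νΓ s) < 0)
    (hweb : ∀ τ₀ z₀ : ℝ, |τ₀| < δ → |z₀| < δ → ∀ s₀ : ℝ, ∃ n₀ ∈ Ioo (-r) r,
      σ * U (-1 + τ₀) (Γ s₀ + n₀ • νΓ s₀ + z₀ • EuclideanSpace.single 2 (1 : ℝ)) 2 = R τ₀ z₀ ∧
      (∀ n ∈ Icc (-r) r, n ≠ n₀ → σ * U (-1 + τ₀) (Γ s₀ + n • νΓ s₀ + z₀ • EuclideanSpace.single 2 (1 : ℝ)) 2 < R τ₀ z₀) ∧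
      DifferentiableAt ℝ (uncurry R) (τ₀, z₀) ∧
      fderiv ℝ (uncurry fun τ y => σ * U (-1 + τ) y 2) (τ₀, Γ s₀ + n₀ • νΓ s₀ + z₀ • EuclideanSpace.single 2 (1 : ℝ)) =
        (fderiv ℝ (uncurry R) (τ₀, z₀)).comp
          ((ContinuousLinearMap.fst ℝ ℝ (EuclideanSpace ℝ (Fin 3))).prod
            ((EuclideanSpace.proj (2 : Fin 3)).comp (ContinuousLinearMap.snd ℝ ℝ (EuclideanSpace ℝ (Fin 3))))))
    (hρ : 0 < ρ) (hμ3 : ContDiff ℝ 3 (uncurry μ))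
    (hslabU : ∀ t : ℝ, |t + 1| < ρ → ∀ x : EuclideanSpace ℝ (Fin 3), |x 2| < ρ → ∀ b : Fin 3, b ≠ 2 →
      fderiv ℝ (U t) x (EuclideanSpace.single 2 1) b = μ t (x 2) * fderiv ℝ (U t) x (EuclideanSpace.single b 1) 2)
    (hτδ : |τ| < δ) (hτρ : |τ| < ρ) (hτh : |τ| < 1 / 2)
    (hson : ∃ a b : ℝ, ∀ z : ℝ, |z| < δ → R τ z = a + b * z) (hμneg : μ (-1 + τ) 0 < 0) :
    ∀ s z : ℝ, |z| < δ → ∀ n₁ ∈ Ioo (-r) r, ∀ n₂ ∈ Ioo (-r) r,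
      σ * U (-1 + τ) (Γ s + n₁ • νΓ s + z • EuclideanSpace.single 2 (1 : ℝ)) 2 = R τ z →
      σ * U (-1 + τ) (Γ 0 + n₂ • νΓ 0 + z • EuclideanSpace.single 2 (1 : ℝ)) 2 = R τ z → n₁ = n₂ := by
  have ht : -1 + τ < 0 := by linarith [(abs_lt.1 hτh).2]
  obtain ⟨hΓd, he2, hunit, hνe, hpt⟩ := line_frame hline hΓ2 hΓunit hν
  set e : EuclideanSpace ℝ (Fin 3) := deriv Γ 0 with he_def
  -- the signed slice and the (analytic) web function at time `τ`
  obtain ⟨F, hF_def⟩ : ∃ F : EuclideanSpace ℝ (Fin 3) → ℝ, F = fun y => σ * U (-1 + τ) y 2 := ⟨_, rfl⟩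
  have hUan : AnalyticOnNhd ℝ (U (-1 + τ)) univ := analyticOnNhd_slice hUcont (bdd_of_hasTypeITimeDecay hUrate) hUmild ht
  have hθan : AnalyticOnNhd ℝ (fun y => U (-1 + τ) y 2) univ := fun x _ =>
    ((EuclideanSpace.proj (𝕜 := ℝ) (2 : Fin 3)).analyticAt _).comp (hUan x (mem_univ _))
  have hFan : AnalyticOnNhd ℝ F univ := by rw [hF_def]; exact fun x hx => analyticAt_const.mul (hθan x hx)
  have hFω : ContDiff ℝ ω F := hFan.contDiff
  have hS : ∀ z : ℝ, |z| < δ → ∀ s : ℝ, ∃ n₀ ∈ Ioo (-r) r, F (frameCLM e (s, n₀, z)) = R τ z ∧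
      ∀ n ∈ Icc (-r) r, n ≠ n₀ → F (frameCLM e (s, n, z)) < R τ z := by
    intro z hz s
    obtain ⟨n₀, hn₀, hval, huniq, -, -⟩ := hweb τ z hτδ hz s
    refine ⟨n₀, hn₀, ?_, fun n hn hne => ?_⟩
    · rw [hF_def, ← hpt]; exact hval
    · rw [hF_def, ← hpt]; exact huniq n hn hne
  set G : ℝ × ℝ → ℝ := webFun F e r δ (R τ) hS with hG_def
  have hspec : ∀ p : ℝ × ℝ, |p.2| < δ → G p ∈ Ioo (-r) r ∧ F (frameCLM e (p.1, G p, p.2)) = R τ p.2 ∧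
      ∀ n ∈ Icc (-r) r, n ≠ G p → F (frameCLM e (p.1, n, p.2)) < R τ p.2 := fun p hp => webFun_spec hS hp
  have hconcF : ∀ z : ℝ, |z| < δ → ∀ s : ℝ, ∀ n ∈ Ioo (-r) r, fderiv ℝ (fderiv ℝ F) (frameCLM e (s, n, z)) (Jvec e) (Jvec e) < 0 := by
    intro z hz s n hn
    have h := hconc τ z hτδ hz s n hn
    rw [← hF_def, hpt, hνe] at h
    exact h
  have hGω : ∀ p : ℝ × ℝ, |p.2| < δ → ContDiffAt ℝ ω G p := fun p hp => contDiffAt_webFun hFω hS hconcF hp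
  -- uniqueness: any maximiser at `(s, z)` is `G (s, z)`
  have huniqG : ∀ s z : ℝ, |z| < δ → ∀ n ∈ Ioo (-r) r, σ * U (-1 + τ) (Γ s + n • νΓ s + z • EuclideanSpace.single 2 (1 : ℝ)) 2 = R τ z →
      n = G (s, z) := by
    intro s z hz n hn hval
    by_contra hne
    have hlt := (hspec (s, z) hz).2.2 n (Ioo_subset_Icc_self hn) hne
    simp only [hF_def] at hlt
    rw [hpt] at hval
    exact absurd hval hlt.ne
  -- parallel webs on a small window (B-T), then on the full window by analyticity in `z`
  obtain ⟨δ', d, hδ', hδ'δ, hmax, -⟩ := sonic_webs_parallel hUrate hUcont hUmild hUdiv hUpol hσ hΓ2 hΓunit hν hline hδ hconc hweb hρ hμ3 hslabU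
    hτδ hτρ hτh hson hμneg
  have habs : ∀ {c : ℝ} {z : ℝ}, z ∈ Ioo (-c) c ↔ |z| < c := fun {c z} => by rw [mem_Ioo, abs_lt]
  have hsmall : ∀ s : ℝ, ∀ z ∈ Ioo (-δ') δ', G (s, z) = G (0, z) := by
    intro s z hz
    have hzδ : |z| < δ := lt_of_lt_of_le (habs.1 hz) hδ'δ
    obtain ⟨hdz, hval, -⟩ := hmax s z hz
    obtain ⟨hdz0, hval0, -⟩ := hmax 0 z hz
    rw [← huniqG s z hzδ (d z) hdz hval, ← huniqG 0 z hzδ (d z) hdz0 hval0]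
  have hfull : ∀ s z : ℝ, |z| < δ → G (s, z) = G (0, z) := by
    intro s z hz
    have han : AnalyticOnNhd ℝ (fun z' : ℝ => G (s, z') - G (0, z')) (Ioo (-δ) δ) := by
      intro z' hz'
      have h1 : AnalyticAt ℝ G (s, z') := (hGω (s, z') (habs.1 hz')).analyticAt
      have h2 : AnalyticAt ℝ G (0, z') := (hGω (0, z') (habs.1 hz')).analyticAt
      have hl1 : AnalyticAt ℝ (fun z'' : ℝ => ((s, z'') : ℝ × ℝ)) z' := analyticAt_const.prod analyticAt_id
      have hl2 : AnalyticAt ℝ (fun z'' : ℝ => (((0 : ℝ), z'') : ℝ × ℝ)) z' := analyticAt_const.prod analyticAt_id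
      exact (h1.comp hl1).sub (h2.comp hl2)
    have h0 : (0 : ℝ) ∈ Ioo (-δ) δ := ⟨by linarith, hδ⟩
    have hev : (fun z' : ℝ => G (s, z') - G (0, z')) =ᶠ[𝓝 (0 : ℝ)] 0 := by
      filter_upwards [isOpen_Ioo.mem_nhds (show (0 : ℝ) ∈ Ioo (-δ') δ' from ⟨by linarith, hδ'⟩)] with z' hz'
      simp only [Pi.zero_apply, sub_eq_zero]
      exact hsmall s z' hz'
    have h := han.eqOn_zero_of_preconnected_of_eventuallyEq_zero isPreconnected_Ioo h0 hev (habs.2 hz)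
    simpa [sub_eq_zero] using h
  intro s z hz n₁ hn₁ n₂ hn₂ h₁ h₂
  rw [huniqG s z hz n₁ hn₁ h₁, huniqG 0 z hz n₂ hn₂ h₂, hfull s z hz]

/-- **B-T on the full window in port-2's space–time web-function currency:** `n₀(τ,s,z) = n₀(τ,0,z)` for all `s` and `|z| < min δ δ₀` (UNIFORM in `τ`). -/
theorem sonic_webs_parallel_timeWeb_window {C : ℝ} {U : ℝ → EuclideanSpace ℝ (Fin 3) → EuclideanSpace ℝ (Fin 3)} {Γ νΓ : ℝ → EuclideanSpace ℝ (Fin 3)}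
    {R μ : ℝ → ℝ → ℝ} {σ r δ ρ τ δ₀ : ℝ} {n₀ : ℝ × ℝ × ℝ → ℝ}
    (hUrate : HasTypeITimeDecay C U) (hUcont : ContinuousOn (uncurry U) (Iio (0 : ℝ) ×ˢ univ))
    (hUmild : ∀ s t : ℝ, s < t → t < 0 → ∀ x, U t x = heatExtension (U s) (t - s) x - oseenDuhamel 1 s U U t x)
    (hUdiv : ∀ t < 0, VectorCalculus.IsDivFree (U t))
    (hUpol : ∀ s < 0, ∀ q, ⟪curl (U s) q, EuclideanSpace.single 2 1⟫_ℝ = 0)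
    (hσ : σ = 1 ∨ σ = -1)
    (hΓ2 : ∀ s, Γ s 2 = 0) (hΓunit : ∀ s, ‖deriv Γ s‖ = 1)
    (hν : ∀ s, νΓ s = WithLp.toLp 2 ![-(deriv Γ s 1), deriv Γ s 0, 0])
    (hline : ∀ s : ℝ, Γ s = s • deriv Γ 0)
    (hδ : 0 < δ)
    (hconc : ∀ τ z : ℝ, |τ| < δ → |z| < δ → ∀ s : ℝ, ∀ n ∈ Ioo (-r) r,
      fderiv ℝ (fderiv ℝ (fun y => σ * U (-1 + τ) y 2)) (Γ s + n • νΓ s + z • EuclideanSpace.single 2 (1 : ℝ)) (νΓ s) (νΓ s) < 0)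
    (hweb : ∀ τ₀ z₀ : ℝ, |τ₀| < δ → |z₀| < δ → ∀ s₀ : ℝ, ∃ n₀ ∈ Ioo (-r) r,
      σ * U (-1 + τ₀) (Γ s₀ + n₀ • νΓ s₀ + z₀ • EuclideanSpace.single 2 (1 : ℝ)) 2 = R τ₀ z₀ ∧
      (∀ n ∈ Icc (-r) r, n ≠ n₀ → σ * U (-1 + τ₀) (Γ s₀ + n • νΓ s₀ + z₀ • EuclideanSpace.single 2 (1 : ℝ)) 2 < R τ₀ z₀) ∧
      DifferentiableAt ℝ (uncurry R) (τ₀, z₀) ∧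
      fderiv ℝ (uncurry fun τ y => σ * U (-1 + τ) y 2) (τ₀, Γ s₀ + n₀ • νΓ s₀ + z₀ • EuclideanSpace.single 2 (1 : ℝ)) =
        (fderiv ℝ (uncurry R) (τ₀, z₀)).comp
          ((ContinuousLinearMap.fst ℝ ℝ (EuclideanSpace ℝ (Fin 3))).prod
            ((EuclideanSpace.proj (2 : Fin 3)).comp (ContinuousLinearMap.snd ℝ ℝ (EuclideanSpace ℝ (Fin 3))))))
    (hρ : 0 < ρ) (hμ3 : ContDiff ℝ 3 (uncurry μ))
    (hslabU : ∀ t : ℝ, |t + 1| < ρ → ∀ x : EuclideanSpace ℝ (Fin 3), |x 2| < ρ → ∀ b : Fin 3, b ≠ 2 →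
      fderiv ℝ (U t) x (EuclideanSpace.single 2 1) b = μ t (x 2) * fderiv ℝ (U t) x (EuclideanSpace.single b 1) 2)
    (hτδ : |τ| < δ) (hτρ : |τ| < ρ) (hτh : |τ| < 1 / 2)
    (hson : ∃ a b : ℝ, ∀ z : ℝ, |z| < δ → R τ z = a + b * z) (hμneg : μ (-1 + τ) 0 < 0)
    (hn₀ : ∀ s z : ℝ, |z| < δ₀ → n₀ (τ, s, z) ∈ Ioo (-r) r ∧
      σ * U (-1 + τ) (frameCLM (deriv Γ 0) (s, n₀ (τ, s, z), z)) 2 = R τ z) :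
    ∀ s z : ℝ, |z| < min δ δ₀ → n₀ (τ, s, z) = n₀ (τ, 0, z) := by
  have hW := sonic_webs_parallel_window hUrate hUcont hUmild hUdiv hUpol hσ hΓ2 hΓunit hν hline hδ hconc hweb hρ hμ3 hslabU hτδ hτρ hτh hson hμneg
  obtain ⟨-, -, -, -, hpt⟩ := line_frame hline hΓ2 hΓunit hν
  intro s z hz
  have hzδ : |z| < δ := lt_of_lt_of_le hz (min_le_left _ _)
  have hz₀ : |z| < δ₀ := lt_of_lt_of_le hz (min_le_right _ _)
  obtain ⟨hm₁, hv₁⟩ := hn₀ s z hz₀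
  obtain ⟨hm₂, hv₂⟩ := hn₀ 0 z hz₀
  rw [← hpt] at hv₁ hv₂
  exact hW s z hzδ _ hm₁ _ hm₂ hv₁ hv₂

/-- ★ **CASE I ON A SPACE–TIME BOX** (the literal S1 of T2B-g17 §7): if EVERY time `|τ| < δ₁` is sonic and `μ(−1,0) < 0`, then for a cross-section maximiser function
`n₀(τ,s,z)` on the box `|τ|, |z| < δ₀` (port-2's `time_web_package_line`), there is `δ₃ > 0` with `n₀(τ,s,z) = n₀(τ,0,z)` for ALL `|τ| < δ₃`, all `s`, all `|z| < δ₃`. -/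
theorem sonic_webs_parallel_timeWeb_box {C : ℝ} {U : ℝ → EuclideanSpace ℝ (Fin 3) → EuclideanSpace ℝ (Fin 3)} {Γ νΓ : ℝ → EuclideanSpace ℝ (Fin 3)}
    {R μ : ℝ → ℝ → ℝ} {σ r δ ρ δ₀ δ₁ : ℝ} {n₀ : ℝ × ℝ × ℝ → ℝ}
    (hUrate : HasTypeITimeDecay C U) (hUcont : ContinuousOn (uncurry U) (Iio (0 : ℝ) ×ˢ univ))
    (hUmild : ∀ s t : ℝ, s < t → t < 0 → ∀ x, U t x = heatExtension (U s) (t - s) x - oseenDuhamel 1 s U U t x)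
    (hUdiv : ∀ t < 0, VectorCalculus.IsDivFree (U t))
    (hUpol : ∀ s < 0, ∀ q, ⟪curl (U s) q, EuclideanSpace.single 2 1⟫_ℝ = 0)
    (hσ : σ = 1 ∨ σ = -1)
    (hΓ2 : ∀ s, Γ s 2 = 0) (hΓunit : ∀ s, ‖deriv Γ s‖ = 1)
    (hν : ∀ s, νΓ s = WithLp.toLp 2 ![-(deriv Γ s 1), deriv Γ s 0, 0])
    (hline : ∀ s : ℝ, Γ s = s • deriv Γ 0)
    (hδ : 0 < δ)
    (hconc : ∀ τ z : ℝ, |τ| < δ → |z| < δ → ∀ s : ℝ, ∀ n ∈ Ioo (-r) r,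
      fderiv ℝ (fderiv ℝ (fun y => σ * U (-1 + τ) y 2)) (Γ s + n • νΓ s + z • EuclideanSpace.single 2 (1 : ℝ)) (νΓ s) (νΓ s) < 0)
    (hweb : ∀ τ₀ z₀ : ℝ, |τ₀| < δ → |z₀| < δ → ∀ s₀ : ℝ, ∃ n₀ ∈ Ioo (-r) r,
      σ * U (-1 + τ₀) (Γ s₀ + n₀ • νΓ s₀ + z₀ • EuclideanSpace.single 2 (1 : ℝ)) 2 = R τ₀ z₀ ∧
      (∀ n ∈ Icc (-r) r, n ≠ n₀ → σ * U (-1 + τ₀) (Γ s₀ + n • νΓ s₀ + z₀ • EuclideanSpace.single 2 (1 : ℝ)) 2 < R τ₀ z₀) ∧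
      DifferentiableAt ℝ (uncurry R) (τ₀, z₀) ∧
      fderiv ℝ (uncurry fun τ y => σ * U (-1 + τ) y 2) (τ₀, Γ s₀ + n₀ • νΓ s₀ + z₀ • EuclideanSpace.single 2 (1 : ℝ)) =
        (fderiv ℝ (uncurry R) (τ₀, z₀)).comp
          ((ContinuousLinearMap.fst ℝ ℝ (EuclideanSpace ℝ (Fin 3))).prod
            ((EuclideanSpace.proj (2 : Fin 3)).comp (ContinuousLinearMap.snd ℝ ℝ (EuclideanSpace ℝ (Fin 3))))))
    (hρ : 0 < ρ) (hμ3 : ContDiff ℝ 3 (uncurry μ))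
    (hslabU : ∀ t : ℝ, |t + 1| < ρ → ∀ x : EuclideanSpace ℝ (Fin 3), |x 2| < ρ → ∀ b : Fin 3, b ≠ 2 →
      fderiv ℝ (U t) x (EuclideanSpace.single 2 1) b = μ t (x 2) * fderiv ℝ (U t) x (EuclideanSpace.single b 1) 2)
    (hμneg : μ (-1) 0 < 0) (hδ₁ : 0 < δ₁)
    (hsonI : ∀ τ : ℝ, |τ| < δ₁ → ∃ a b : ℝ, ∀ z : ℝ, |z| < δ → R τ z = a + b * z)
    (hδ₀ : 0 < δ₀)
    (hn₀ : ∀ τ s z : ℝ, |τ| < δ₀ → |z| < δ₀ → n₀ (τ, s, z) ∈ Ioo (-r) r ∧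
      σ * U (-1 + τ) (frameCLM (deriv Γ 0) (s, n₀ (τ, s, z), z)) 2 = R τ z) :
    ∃ δ₃ : ℝ, 0 < δ₃ ∧ δ₃ ≤ δ₀ ∧ δ₃ ≤ δ ∧ ∀ τ s z : ℝ, |τ| < δ₃ → |z| < δ₃ → n₀ (τ, s, z) = n₀ (τ, 0, z) := by
  -- `μ(−1+τ, 0) < 0` for small `τ` (continuity of `μ` in time)
  have hμc : Continuous fun τ : ℝ => μ (-1 + τ) 0 := by
    have : (fun τ : ℝ => μ (-1 + τ) 0) = uncurry μ ∘ fun τ : ℝ => ((-1 + τ : ℝ), (0 : ℝ)) := by funext τ; rfl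
    rw [this]; exact hμ3.continuous.comp ((continuous_const.add continuous_id).prodMk continuous_const)
  have h0 : μ (-1 + 0) 0 < 0 := by simpa using hμneg
  obtain ⟨ε, hε, hεμ⟩ : ∃ ε > 0, ∀ τ : ℝ, dist τ 0 < ε → μ (-1 + τ) 0 < 0 :=
    Metric.eventually_nhds_iff.1 (hμc.continuousAt.eventually (gt_mem_nhds h0))
  set δ₃ : ℝ := min (min ε δ₁) (min (min δ ρ) (min (1 / 2) δ₀)) with hδ₃
  have hδ₃pos : 0 < δ₃ := lt_min (lt_min hε hδ₁) (lt_min (lt_min hδ hρ) (lt_min (by norm_num) hδ₀))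
  have h1 : δ₃ ≤ ε := (min_le_left _ _).trans (min_le_left _ _)
  have h2 : δ₃ ≤ δ₁ := (min_le_left _ _).trans (min_le_right _ _)
  have h3 : δ₃ ≤ δ := ((min_le_right _ _).trans (min_le_left _ _)).trans (min_le_left _ _)
  have h4 : δ₃ ≤ ρ := ((min_le_right _ _).trans (min_le_left _ _)).trans (min_le_right _ _)
  have h5 : δ₃ ≤ 1 / 2 := ((min_le_right _ _).trans (min_le_right _ _)).trans (min_le_left _ _)
  have h6 : δ₃ ≤ δ₀ := ((min_le_right _ _).trans (min_le_right _ _)).trans (min_le_right _ _)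
  refine ⟨δ₃, hδ₃pos, h6, h3, fun τ s z hτ hz => ?_⟩
  have hW := sonic_webs_parallel_timeWeb_window (τ := τ) (δ₀ := δ₀) (n₀ := n₀) hUrate hUcont hUmild hUdiv hUpol hσ hΓ2 hΓunit hν hline hδ hconc hweb hρ hμ3
    hslabU (lt_of_lt_of_le hτ h3) (lt_of_lt_of_le hτ h4) (lt_of_lt_of_le hτ h5) (hsonI τ (lt_of_lt_of_le hτ h2)) (hεμ τ (by simpa using lt_of_lt_of_le hτ h1))
    (fun s' z' hz' => hn₀ τ s' z' (lt_of_lt_of_le hτ h6) hz')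
  exact hW s z (lt_min (lt_of_lt_of_le hz h3) (lt_of_lt_of_le hz h6))

end Summit.NavierStokesRegularity.NavierStokesRegularity.Theorems.PoloidalWindowDoorLrcModEntireSonicWebsParallelWindow

end
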